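import Mathlib.Analysis.Calculus.ParametricIntegral
import Mathlib.Analysis.SpecialFunctions.ExpDeriv
import Mathlib.Analysis.SpecialFunctions.Trigonometric.Deriv
import Mathlib.Analysis.InnerProductSpace.Calculus
import Literature.MeasureTheory.Hausdorff.SphereHausdorffFinite
import Literature.MeasureTheory.Hausdorff.SphericalCap
import HarnessLib

/-!
# Rotation invariance of the spherical Hausdorff measure: Killing fields integrate to zero

Let `V` be a real inner product space of dimension `k + 1`, `S_r = {‖x‖ = r}` a round sphere and
`σ = μHE[k]⌊S_r` its (Euclidean-normalised) Hausdorff measure. For an orthonormal pair `u, v`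
the one-parameter group of rotations of the plane `span {u, v}`,
`R_θ x = x + (cos θ - 1)(⟪u,x⟫ u + ⟪v,x⟫ v) + sin θ (⟪u,x⟫ v - ⟪v,x⟫ u)`,
consists of linear isometries preserving `S_r`, hence `σ` (`map_planeRotation_restrict_sphere`);
differentiating `θ ↦ ∫ F (R_θ x) dσ(x) = ∫ F dσ` at `θ = 0` under the integral sign gives the
**Killing-field identity** (`integral_sphere_fderiv_rotation_eq_zero`):

  `∫_{S_r} DF(x)[⟪u,x⟫ v - ⟪v,x⟫ u] dμHE[k](x) = 0`   for every `C¹` function `F : V → ℝ`.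

Applied to `F(x) = ⟪v,x⟫ e^{α + β⟪u,x⟫}` and summed over an orthonormal basis `(v_j)` of `uᗮ`
(`Σ_j ⟪v_j,x⟫² = r² - ⟪u,x⟫²` on `S_r`) it yields the integration-by-parts identity behind the
Bessel equation for `a ↦ ∫_{S} e^{a ω₁}` (`integral_sphere_exp_inner_mul_inner`):

  `k ∫_{S_r} ⟪u,x⟫ e^{α + β⟪u,x⟫} dμHE[k] = β ∫_{S_r} (r² - ⟪u,x⟫²) e^{α + β⟪u,x⟫} dμHE[k]`,

which is the sphere case of Colding–Minicozzi's self-adjointness identity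
`[⟨(x - x_s)^T, y^T⟩]_s = -t_s [⟨x^⊥, y^⊥⟩]_s` (Colding–Minicozzi 2012, (7.16)) used in their proof
that the entropy of a self-shrinker is achieved at `(x₀, t₀) = (0, 1)` (ibid. Lemma 7.10); it is the
analytic input of `Literature.Geometry.Riemannian.Stone1994_cylinderEntropy`. No divergence theorem
on the sphere is needed: only the isometry invariance of `μHE[k]`.

## References

* T. H. Colding, W. P. Minicozzi II, *Generic mean curvature flow I; generic singularities*,
  Ann. of Math. 175 (2012), §3 (the operator `𝓛`), §7.2 (7.13)–(7.16), Lemma 7.10.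
* H. Federer, *Geometric measure theory* (1969), 2.10.11, 3.2.13.
-/

noncomputable section

open Set Metric Module Submodule Filter
open _root_.MeasureTheory _root_.MeasureTheory.Measure
open scoped ENNReal NNReal Topology RealInnerProductSpace

namespace Literature.MeasureTheory.Hausdorff

variable {V : Type*} [NormedAddCommGroup V] [InnerProductSpace ℝ V]

/-! ### Plane rotations -/

section Rotation

variable {u v : V}

/-- The plane rotation `R_θ` as a continuous linear map. [folklore] -/
theorem planeRotation_clm_apply (u v : V) (θ : ℝ) (x : V) :
    (ContinuousLinearMap.id ℝ V +
      (Real.cos θ - 1) • ((innerSL ℝ u).smulRight u + (innerSL ℝ v).smulRight v) +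
      Real.sin θ • ((innerSL ℝ u).smulRight v - (innerSL ℝ v).smulRight u)) x =
    x + (Real.cos θ - 1) • (⟪u, x⟫ • u + ⟪v, x⟫ • v) + Real.sin θ • (⟪u, x⟫ • v - ⟪v, x⟫ • u) := by
  simp [ContinuousLinearMap.smulRight_apply, innerSL_apply_apply]

/-- **Plane rotations are isometries**: for an orthonormal pair `u, v`,
`‖x + (cos θ - 1)(⟪u,x⟫ u + ⟪v,x⟫ v) + sin θ (⟪u,x⟫ v - ⟪v,x⟫ u)‖ = ‖x‖`. [folklore] -/
theorem norm_planeRotation (hu : ‖u‖ = 1) (hv : ‖v‖ = 1) (huv : ⟪u, v⟫ = 0) (θ : ℝ) (x : V) :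
    ‖x + (Real.cos θ - 1) • (⟪u, x⟫ • u + ⟪v, x⟫ • v) + Real.sin θ • (⟪u, x⟫ • v - ⟪v, x⟫ • u)‖ =
      ‖x‖ := by
  have huu : ⟪u, u⟫ = 1 := by rw [real_inner_self_eq_norm_sq, hu, one_pow]
  have hvv : ⟪v, v⟫ = 1 := by rw [real_inner_self_eq_norm_sq, hv, one_pow]
  have hvu : ⟪v, u⟫ = 0 := by rw [real_inner_comm, huv]
  set a := ⟪u, x⟫ with ha
  set b := ⟪v, x⟫ with hb
  have hxu : ⟪x, u⟫ = a := by rw [ha, real_inner_comm]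
  have hxv : ⟪x, v⟫ = b := by rw [hb, real_inner_comm]
  have hsq : ‖x + (Real.cos θ - 1) • (a • u + b • v) + Real.sin θ • (a • v - b • u)‖ ^ 2 = ‖x‖ ^ 2 := by
    rw [← real_inner_self_eq_norm_sq, ← real_inner_self_eq_norm_sq x]
    simp only [inner_add_left, inner_add_right, inner_smul_left, inner_smul_right, inner_sub_left,
      inner_sub_right, huu, hvv, huv, hvu, hxu, hxv, ← ha, ← hb, RCLike.conj_to_real]
    linear_combination (a ^ 2 + b ^ 2) * Real.sin_sq_add_cos_sq θ
  rw [← Real.sqrt_sq (norm_nonneg (x + _ + _)), hsq, Real.sqrt_sq (norm_nonneg x)]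

/-- The velocity of the rotation: `d/dθ R_θ x = -sin θ (⟪u,x⟫ u + ⟪v,x⟫ v) + cos θ (⟪u,x⟫ v - ⟪v,x⟫ u)`;
at `θ = 0` this is the Killing field `⟪u,x⟫ v - ⟪v,x⟫ u`. [folklore] -/
theorem hasDerivAt_planeRotation (u v x : V) (θ : ℝ) :
    HasDerivAt (fun θ : ℝ ↦
        x + (Real.cos θ - 1) • (⟪u, x⟫ • u + ⟪v, x⟫ • v) + Real.sin θ • (⟪u, x⟫ • v - ⟪v, x⟫ • u))
      (-Real.sin θ • (⟪u, x⟫ • u + ⟪v, x⟫ • v) + Real.cos θ • (⟪u, x⟫ • v - ⟪v, x⟫ • u)) θ := by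
  have h1 := ((Real.hasDerivAt_cos θ).sub_const 1).smul_const (⟪u, x⟫ • u + ⟪v, x⟫ • v)
  have h2 := (Real.hasDerivAt_sin θ).smul_const (⟪u, x⟫ • v - ⟪v, x⟫ • u)
  have h := (h1.const_add x).add h2
  exact h

/-- A crude bound for the velocity field: `‖-sin θ P x + cos θ J x‖ ≤ 4 ‖x‖` for unit `u, v`.
[folklore] -/
theorem norm_planeRotation_deriv_le (hu : ‖u‖ = 1) (hv : ‖v‖ = 1) (θ : ℝ) (x : V) :
    ‖-Real.sin θ • (⟪u, x⟫ • u + ⟪v, x⟫ • v) + Real.cos θ • (⟪u, x⟫ • v - ⟪v, x⟫ • u)‖ ≤ 4 * ‖x‖ := by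
  have ha : |⟪u, x⟫| ≤ ‖x‖ := by
    have := abs_real_inner_le_norm u x; rwa [hu, one_mul] at this
  have hb : |⟪v, x⟫| ≤ ‖x‖ := by
    have := abs_real_inner_le_norm v x; rwa [hv, one_mul] at this
  have hP : ‖⟪u, x⟫ • u + ⟪v, x⟫ • v‖ ≤ 2 * ‖x‖ := by
    refine (norm_add_le _ _).trans ?_
    rw [norm_smul, norm_smul, hu, hv, mul_one, mul_one, Real.norm_eq_abs, Real.norm_eq_abs]
    linarith
  have hJ : ‖⟪u, x⟫ • v - ⟪v, x⟫ • u‖ ≤ 2 * ‖x‖ := by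
    refine (norm_sub_le _ _).trans ?_
    rw [norm_smul, norm_smul, hu, hv, mul_one, mul_one, Real.norm_eq_abs, Real.norm_eq_abs]
    linarith
  refine (norm_add_le _ _).trans ?_
  rw [norm_smul, norm_smul, norm_neg, Real.norm_eq_abs, Real.norm_eq_abs]
  have hs := Real.abs_sin_le_one θ
  have hc := Real.abs_cos_le_one θ
  nlinarith [norm_nonneg (⟪u, x⟫ • u + ⟪v, x⟫ • v), norm_nonneg (⟪u, x⟫ • v - ⟪v, x⟫ • u),
    abs_nonneg (Real.sin θ), abs_nonneg (Real.cos θ), norm_nonneg x]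

variable [FiniteDimensional ℝ V] [MeasurableSpace V] [BorelSpace V]

/-- **Rotation invariance of the spherical Hausdorff measure**: the plane rotation `R_θ` maps
`μHE[k]⌊{‖x‖ = r}` to itself (it is a surjective linear isometry preserving the sphere, and
`μHE[k]` is isometry invariant). [folklore] -/
theorem map_planeRotation_restrict_sphere (hu : ‖u‖ = 1) (hv : ‖v‖ = 1) (huv : ⟪u, v⟫ = 0)
    (θ : ℝ) (k : ℕ) (r : ℝ) :
    Measure.map (fun x : V ↦
        x + (Real.cos θ - 1) • (⟪u, x⟫ • u + ⟪v, x⟫ • v) + Real.sin θ • (⟪u, x⟫ • v - ⟪v, x⟫ • u))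
      ((μHE[k] : Measure V).restrict (sphere 0 r)) = (μHE[k] : Measure V).restrict (sphere 0 r) := by
  set L : V →L[ℝ] V := ContinuousLinearMap.id ℝ V +
      (Real.cos θ - 1) • ((innerSL ℝ u).smulRight u + (innerSL ℝ v).smulRight v) +
      Real.sin θ • ((innerSL ℝ u).smulRight v - (innerSL ℝ v).smulRight u) with hL_def
  have hL : ∀ x, L x = x + (Real.cos θ - 1) • (⟪u, x⟫ • u + ⟪v, x⟫ • v) +
      Real.sin θ • (⟪u, x⟫ • v - ⟪v, x⟫ • u) := fun x ↦ planeRotation_clm_apply u v θ x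
  have hnorm : ∀ x, ‖L x‖ = ‖x‖ := fun x ↦ by rw [hL]; exact norm_planeRotation hu hv huv θ x
  have hiso : Isometry L := AddMonoidHomClass.isometry_of_norm L hnorm
  have hsurj : Function.Surjective L :=
    LinearMap.surjective_of_injective (f := (L : V →ₗ[ℝ] V)) hiso.injective
  have hrange : Set.range L = univ := Set.range_eq_univ.2 hsurj
  have hfun : (fun x : V ↦ x + (Real.cos θ - 1) • (⟪u, x⟫ • u + ⟪v, x⟫ • v) +
      Real.sin θ • (⟪u, x⟫ • v - ⟪v, x⟫ • u)) = L := funext fun x ↦ (hL x).symm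
  have hpre : L ⁻¹' sphere (0 : V) r = sphere 0 r := by
    ext x
    simp only [mem_preimage, mem_sphere_zero_iff_norm, hnorm]
  have h1 : Measure.map L ((μHE[k] : Measure V).restrict (sphere 0 r)) =
      (Measure.map L (μHE[k] : Measure V)).restrict (sphere 0 r) := by
    rw [Measure.restrict_map L.continuous.measurable isClosed_sphere.measurableSet, hpre]
  rw [hfun, h1, hiso.map_euclideanHausdorffMeasure, hrange, Measure.restrict_univ]

/-- Integrals over the sphere are invariant under plane rotations. [folklore] -/
theorem integral_comp_planeRotation_sphere (hu : ‖u‖ = 1) (hv : ‖v‖ = 1) (huv : ⟪u, v⟫ = 0)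
    (θ : ℝ) (k : ℕ) (r : ℝ) {F : V → ℝ} (hF : Continuous F) :
    ∫ x in sphere (0 : V) r, F (x + (Real.cos θ - 1) • (⟪u, x⟫ • u + ⟪v, x⟫ • v) +
        Real.sin θ • (⟪u, x⟫ • v - ⟪v, x⟫ • u)) ∂(μHE[k] : Measure V) =
      ∫ x in sphere (0 : V) r, F x ∂(μHE[k] : Measure V) := by
  have hR : Continuous (fun x : V ↦ x + (Real.cos θ - 1) • (⟪u, x⟫ • u + ⟪v, x⟫ • v) +
      Real.sin θ • (⟪u, x⟫ • v - ⟪v, x⟫ • u)) := by fun_prop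
  have h := integral_map (μ := (μHE[k] : Measure V).restrict (sphere 0 r)) hR.measurable.aemeasurable
    (f := F) (by rw [map_planeRotation_restrict_sphere hu hv huv θ k r]; exact hF.aestronglyMeasurable)
  rw [map_planeRotation_restrict_sphere hu hv huv θ k r] at h
  exact h.symm

/-- **Killing fields integrate to zero on round spheres.** For an orthonormal pair `u, v` in a
`(k+1)`-dimensional real inner product space and a `C¹` function `F`,
`∫_{‖x‖ = r} DF(x)[⟪u,x⟫ v - ⟪v,x⟫ u] dμHE[k](x) = 0` (derivative at `θ = 0` of the constant
function `θ ↦ ∫ F ∘ R_θ dσ`). [folklore] -/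
theorem integral_sphere_fderiv_rotation_eq_zero {k : ℕ} (hV : finrank ℝ V = k + 1)
    (hu : ‖u‖ = 1) (hv : ‖v‖ = 1) (huv : ⟪u, v⟫ = 0) (r : ℝ) {F : V → ℝ} (hF : ContDiff ℝ 1 F) :
    ∫ x in sphere (0 : V) r, fderiv ℝ F x (⟪u, x⟫ • v - ⟪v, x⟫ • u) ∂(μHE[k] : Measure V) = 0 := by
  set σ : Measure V := (μHE[k] : Measure V).restrict (sphere 0 r) with hσ_def
  haveI : IsFiniteMeasure σ := ⟨by
    rw [hσ_def, Measure.restrict_apply_univ]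
    exact euclideanHausdorffMeasure_sphere_lt_top hV r⟩
  -- the rotation, its velocity
  set R : ℝ → V → V := fun θ x ↦
    x + (Real.cos θ - 1) • (⟪u, x⟫ • u + ⟪v, x⟫ • v) + Real.sin θ • (⟪u, x⟫ • v - ⟪v, x⟫ • u)
    with hR_def
  set R' : ℝ → V → V := fun θ x ↦
    -Real.sin θ • (⟪u, x⟫ • u + ⟪v, x⟫ • v) + Real.cos θ • (⟪u, x⟫ • v - ⟪v, x⟫ • u) with hR'_def
  have hR0 : ∀ x, R 0 x = x := fun x ↦ by simp [hR_def]
  have hR'0 : ∀ x, R' 0 x = ⟪u, x⟫ • v - ⟪v, x⟫ • u := fun x ↦ by simp [hR'_def]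
  have hRn : ∀ θ x, ‖R θ x‖ = ‖x‖ := fun θ x ↦ norm_planeRotation hu hv huv θ x
  have hRc : ∀ θ, Continuous (R θ) := fun θ ↦ by simp only [hR_def]; fun_prop
  have hR'c : ∀ θ, Continuous (R' θ) := fun θ ↦ by simp only [hR'_def]; fun_prop
  have hfd : Differentiable ℝ F := hF.differentiable one_ne_zero
  have hfc : Continuous (fderiv ℝ F) := hF.continuous_fderiv one_ne_zero
  -- a bound for `DF` on the closed ball of radius `|r|`
  obtain ⟨C, hC⟩ := (isCompact_closedBall (0 : V) |r|).exists_bound_of_continuousOn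
    hfc.continuousOn
  have hmem : ∀ θ, ∀ x ∈ sphere (0 : V) r, R θ x ∈ closedBall (0 : V) |r| := by
    intro θ x hx
    rw [mem_closedBall, dist_zero_right, hRn, mem_sphere_zero_iff_norm.1 hx]
    exact le_abs_self r
  -- differentiation under the integral sign at `θ = 0`
  have hderiv : HasDerivAt (fun θ ↦ ∫ x, F (R θ x) ∂σ)
      (∫ x, fderiv ℝ F (R 0 x) (R' 0 x) ∂σ) 0 := by
    refine (hasDerivAt_integral_of_dominated_loc_of_deriv_le (μ := σ) (x₀ := (0 : ℝ))
      (F := fun θ x ↦ F (R θ x)) (F' := fun θ x ↦ fderiv ℝ F (R θ x) (R' θ x))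
      (s := ball 0 1) (bound := fun _ ↦ max C 0 * (4 * |r|)) (ball_mem_nhds _ one_pos)
      (Eventually.of_forall fun θ ↦ (hF.continuous.comp (hRc θ)).aestronglyMeasurable)
      ?_ ((hfc.comp (hRc 0)).clm_apply (hR'c 0)).aestronglyMeasurable ?_ (integrable_const _) ?_).2
    · -- integrability of `F ∘ R 0` on the sphere: bounded on a set of finite measure
      obtain ⟨M, hM⟩ := (isCompact_sphere (0 : V) r).exists_bound_of_continuousOn
        (hF.continuous.comp (hRc 0)).continuousOn
      refine Measure.integrableOn_of_bounded (M := M) (euclideanHausdorffMeasure_sphere_lt_top hV r).ne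
        (hF.continuous.comp (hRc 0)).aestronglyMeasurable ?_
      exact (ae_restrict_iff' isClosed_sphere.measurableSet).2 (ae_of_all _ fun x hx ↦ hM x hx)
    · refine (ae_restrict_iff' isClosed_sphere.measurableSet).2 (ae_of_all _ fun x hx θ _ ↦ ?_)
      have hx' : ‖x‖ = r := mem_sphere_zero_iff_norm.1 hx
      calc ‖fderiv ℝ F (R θ x) (R' θ x)‖ ≤ ‖fderiv ℝ F (R θ x)‖ * ‖R' θ x‖ :=
            ContinuousLinearMap.le_opNorm _ _
        _ ≤ max C 0 * (4 * |r|) := by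
            refine mul_le_mul ((hC _ (hmem θ x hx)).trans (le_max_left _ _)) ?_ (norm_nonneg _)
              (le_max_right _ _)
            calc ‖R' θ x‖ ≤ 4 * ‖x‖ := norm_planeRotation_deriv_le hu hv θ x
              _ ≤ 4 * |r| := by rw [hx']; exact mul_le_mul_of_nonneg_left (le_abs_self r) (by norm_num)
    · refine ae_of_all _ fun x θ _ ↦ ?_
      exact (hfd (R θ x)).hasFDerivAt.comp_hasDerivAt θ (hasDerivAt_planeRotation u v x θ)
  -- the integral is constant in `θ`
  have hconst : (fun θ ↦ ∫ x, F (R θ x) ∂σ) = fun _ ↦ ∫ x, F x ∂σ := by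
    funext θ
    exact integral_comp_planeRotation_sphere hu hv huv θ k r hF.continuous
  rw [hconst] at hderiv
  have h0 := hderiv.unique (hasDerivAt_const (0 : ℝ) (∫ x, F x ∂σ))
  simp only [hR0, hR'0] at h0
  exact h0

end Rotation

/-! ### The integration-by-parts identity for `e^{α + β⟪u,x⟫}` on spheres -/

section ExpInner

variable [FiniteDimensional ℝ V] [MeasurableSpace V] [BorelSpace V] {u v : V}

/-- The Killing identity for `F(x) = ⟪v,x⟫ e^{α + β⟪u,x⟫}` (`u ⊥ v` unit):
`∫_{S_r} ⟪u,x⟫ e^{α + β⟪u,x⟫} = β ∫_{S_r} ⟪v,x⟫² e^{α + β⟪u,x⟫}`. [folklore] -/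
theorem integral_sphere_inner_mul_exp_eq {k : ℕ} (hV : finrank ℝ V = k + 1) (hu : ‖u‖ = 1) (hv : ‖v‖ = 1)
    (huv : ⟪u, v⟫ = 0) (r α β : ℝ) :
    ∫ x in sphere (0 : V) r, ⟪u, x⟫ * Real.exp (α + β * ⟪u, x⟫) ∂(μHE[k] : Measure V) =
      β * ∫ x in sphere (0 : V) r, ⟪v, x⟫ ^ 2 * Real.exp (α + β * ⟪u, x⟫) ∂(μHE[k] : Measure V) := by
  have hvv : ⟪v, v⟫ = 1 := by rw [real_inner_self_eq_norm_sq, hv, one_pow]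
  have hvu : ⟪v, u⟫ = 0 := by rw [real_inner_comm, huv]
  have huu : ⟪u, u⟫ = 1 := by rw [real_inner_self_eq_norm_sq, hu, one_pow]
  -- `F(x) = ⟪v,x⟫ e^{α + β⟪u,x⟫}` and its derivative
  set F : V → ℝ := fun x ↦ ⟪v, x⟫ * Real.exp (α + β * ⟪u, x⟫) with hF_def
  have hF : ContDiff ℝ 1 F :=
    (contDiff_const.inner ℝ contDiff_id).mul
      ((contDiff_const.add (contDiff_const.mul (contDiff_const.inner ℝ contDiff_id))).exp)
  have hderiv : ∀ x, HasFDerivAt F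
      (⟪v, x⟫ • (Real.exp (α + β * ⟪u, x⟫) • (β • innerSL ℝ u)) +
        Real.exp (α + β * ⟪u, x⟫) • innerSL ℝ v) x := by
    intro x
    have h1 : HasFDerivAt (fun x : V ↦ ⟪v, x⟫) (innerSL ℝ v) x := (innerSL ℝ v).hasFDerivAt
    have h2 : HasFDerivAt (fun x : V ↦ α + β * ⟪u, x⟫) (β • innerSL ℝ u) x :=
      ((innerSL ℝ u).hasFDerivAt.const_mul β).const_add α
    have h3 := h2.exp
    exact h1.mul h3
  have hval : ∀ x, fderiv ℝ F x (⟪u, x⟫ • v - ⟪v, x⟫ • u) =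
      ⟪u, x⟫ * Real.exp (α + β * ⟪u, x⟫) - β * (⟪v, x⟫ ^ 2 * Real.exp (α + β * ⟪u, x⟫)) := by
    intro x
    rw [(hderiv x).fderiv]
    simp only [_root_.add_apply, _root_.smul_apply, innerSL_apply_apply,
      inner_sub_right, inner_smul_right, huu, hvv, huv, hvu, smul_eq_mul]
    ring
  have h0 := integral_sphere_fderiv_rotation_eq_zero hV hu hv huv r hF
  simp_rw [hval] at h0
  -- split the integral
  have hfin : (μHE[k] : Measure V) (sphere (0 : V) r) < ⊤ := euclideanHausdorffMeasure_sphere_lt_top hV r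
  have hint : ∀ {G : V → ℝ}, Continuous G → IntegrableOn G (sphere (0 : V) r) (μHE[k] : Measure V) := by
    intro G hG
    obtain ⟨M, hM⟩ := (isCompact_sphere (0 : V) r).exists_bound_of_continuousOn hG.continuousOn
    exact Measure.integrableOn_of_bounded (M := M) hfin.ne hG.aestronglyMeasurable
      ((ae_restrict_iff' isClosed_sphere.measurableSet).2 (ae_of_all _ fun x hx ↦ hM x hx))
  have hi1 : IntegrableOn (fun x : V ↦ ⟪u, x⟫ * Real.exp (α + β * ⟪u, x⟫)) (sphere (0 : V) r)
      (μHE[k] : Measure V) := hint (by fun_prop)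
  have hi2 : IntegrableOn (fun x : V ↦ β * (⟪v, x⟫ ^ 2 * Real.exp (α + β * ⟪u, x⟫))) (sphere (0 : V) r)
      (μHE[k] : Measure V) := hint (by fun_prop)
  rw [integral_sub hi1 hi2, sub_eq_zero, integral_const_mul] at h0
  exact h0

/-- **The integration-by-parts identity on round spheres** (sphere case of Colding–Minicozzi
2012, (7.16); equivalently the Bessel equation for `a ↦ ∫_S e^{a ω₁}`): in a `(k+1)`-dimensional
real inner product space, for a unit vector `u`, any radius `r` and reals `α, β`,
`k ∫_{‖x‖ = r} ⟪u,x⟫ e^{α + β⟪u,x⟫} dμHE[k] = β ∫_{‖x‖ = r} (r² - ⟪u,x⟫²) e^{α + β⟪u,x⟫} dμHE[k]`.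
Proof: sum the Killing identities `integral_sphere_inner_mul_exp_eq` over an orthonormal basis of
`uᗮ` and use `Σ_j ⟪v_j,x⟫² = ‖x‖² - ⟪u,x⟫²`. [cite: ColdingMinicozzi2012, (7.16)] -/
theorem integral_sphere_exp_inner_mul_inner {k : ℕ} (hV : finrank ℝ V = k + 1) (hu : ‖u‖ = 1)
    (r α β : ℝ) :
    (k : ℝ) * ∫ x in sphere (0 : V) r, ⟪u, x⟫ * Real.exp (α + β * ⟪u, x⟫) ∂(μHE[k] : Measure V) =
      β * ∫ x in sphere (0 : V) r, (r ^ 2 - ⟪u, x⟫ ^ 2) * Real.exp (α + β * ⟪u, x⟫)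
        ∂(μHE[k] : Measure V) := by
  haveI : Fact (finrank ℝ V = k + 1) := ⟨hV⟩
  have hu0 : u ≠ 0 := fun h ↦ by simp [h] at hu
  set K : Submodule ℝ V := (ℝ ∙ u)ᗮ with hK_def
  have hK : finrank ℝ K = k := finrank_orthogonal_span_singleton hu0
  set b : OrthonormalBasis (Fin k) ℝ K := (stdOrthonormalBasis ℝ K).reindex (finCongr hK) with hb_def
  -- each basis vector gives one Killing identity
  have hj : ∀ j : Fin k,
      ∫ x in sphere (0 : V) r, ⟪u, x⟫ * Real.exp (α + β * ⟪u, x⟫) ∂(μHE[k] : Measure V) =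
        β * ∫ x in sphere (0 : V) r, ⟪(b j : V), x⟫ ^ 2 * Real.exp (α + β * ⟪u, x⟫)
          ∂(μHE[k] : Measure V) := by
    intro j
    have hv : ‖(b j : V)‖ = 1 := by rw [Submodule.norm_coe]; exact b.orthonormal.1 j
    have huv : ⟪u, (b j : V)⟫ = 0 := inner_pole_eq_zero (b j)
    exact integral_sphere_inner_mul_exp_eq hV hu hv huv r α β
  -- Parseval in `uᗮ`: `Σ_j ⟪b j, x⟫² = ‖x‖² - ⟪u,x⟫²`
  have hparseval : ∀ x : V, ∑ j, ⟪(b j : V), x⟫ ^ 2 = ‖x‖ ^ 2 - ⟪u, x⟫ ^ 2 := by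
    intro x
    rw [← norm_sq_orthogonalProjectionOnto_orthogonal_singleton hu x, ← b.sum_sq_inner_right]
    refine Finset.sum_congr rfl fun j _ ↦ ?_
    rw [inner_orthogonalProjectionOnto_eq_of_mem_left]
  -- integrability
  have hfin : (μHE[k] : Measure V) (sphere (0 : V) r) < ⊤ := euclideanHausdorffMeasure_sphere_lt_top hV r
  have hint : ∀ {G : V → ℝ}, Continuous G → IntegrableOn G (sphere (0 : V) r) (μHE[k] : Measure V) := by
    intro G hG
    obtain ⟨M, hM⟩ := (isCompact_sphere (0 : V) r).exists_bound_of_continuousOn hG.continuousOn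
    exact Measure.integrableOn_of_bounded (M := M) hfin.ne hG.aestronglyMeasurable
      ((ae_restrict_iff' isClosed_sphere.measurableSet).2 (ae_of_all _ fun x hx ↦ hM x hx))
  -- sum the identities
  have hsum : (k : ℝ) * ∫ x in sphere (0 : V) r, ⟪u, x⟫ * Real.exp (α + β * ⟪u, x⟫) ∂(μHE[k] : Measure V) =
      β * ∫ x in sphere (0 : V) r, (∑ j, ⟪(b j : V), x⟫ ^ 2) * Real.exp (α + β * ⟪u, x⟫)
        ∂(μHE[k] : Measure V) := by
    have h1 : (k : ℝ) * ∫ x in sphere (0 : V) r, ⟪u, x⟫ * Real.exp (α + β * ⟪u, x⟫) ∂(μHE[k] : Measure V)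
        = ∑ j : Fin k, β * ∫ x in sphere (0 : V) r, ⟪(b j : V), x⟫ ^ 2 * Real.exp (α + β * ⟪u, x⟫)
          ∂(μHE[k] : Measure V) := by
      rw [Finset.sum_congr rfl fun j _ ↦ (hj j).symm, Finset.sum_const, Finset.card_univ,
        Fintype.card_fin, nsmul_eq_mul]
    rw [h1, ← Finset.mul_sum, ← integral_finsetSum _ fun j _ ↦ hint (by fun_prop)]
    congr 1
    refine integral_congr_ae (ae_of_all _ fun x ↦ ?_)
    simp only [Finset.sum_mul]
  rw [hsum]
  congr 1
  refine setIntegral_congr_fun isClosed_sphere.measurableSet fun x hx ↦ ?_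
  rw [hparseval x, mem_sphere_zero_iff_norm.1 hx]

/-- **The integration-by-parts identity, non-normalised direction**: for any vector `y` (not
necessarily a unit vector), radius `r` and reals `α, β`,
`k ∫_{‖x‖ = r} ⟪y,x⟫ e^{α + β⟪y,x⟫} dμHE[k] = β ∫_{‖x‖ = r} (r²‖y‖² - ⟪y,x⟫²) e^{α + β⟪y,x⟫} dμHE[k]`
(apply `integral_sphere_exp_inner_mul_inner` to `u = y/‖y‖`, `β ‖y‖`; trivial for `y = 0`). This is
exactly the sphere case `[⟨(x - x_s)^T, y^T⟩]_s = -t_s [⟨x^⊥, y^⊥⟩]_s` of Colding–Minicozzi 2012,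
(7.16), with `x_s = s y`, `β = s/(2 t_s)`. [cite: ColdingMinicozzi2012, (7.16)] -/
theorem integral_sphere_exp_inner_mul_inner' {k : ℕ} (hV : finrank ℝ V = k + 1) (y : V)
    (r α β : ℝ) :
    (k : ℝ) * ∫ x in sphere (0 : V) r, ⟪y, x⟫ * Real.exp (α + β * ⟪y, x⟫) ∂(μHE[k] : Measure V) =
      β * ∫ x in sphere (0 : V) r, (r ^ 2 * ‖y‖ ^ 2 - ⟪y, x⟫ ^ 2) * Real.exp (α + β * ⟪y, x⟫)
        ∂(μHE[k] : Measure V) := by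
  by_cases hy : y = 0
  · simp [hy]
  have hny : 0 < ‖y‖ := norm_pos_iff.2 hy
  set u : V := ‖y‖⁻¹ • y with hu_def
  have hu : ‖u‖ = 1 := by
    rw [hu_def, norm_smul, norm_inv, norm_norm, inv_mul_cancel₀ hny.ne']
  have hyu : y = ‖y‖ • u := by rw [hu_def, smul_inv_smul₀ hny.ne']
  have hinner : ∀ x, ⟪y, x⟫ = ‖y‖ * ⟪u, x⟫ := fun x ↦ by
    rw [hyu, inner_smul_left, RCLike.conj_to_real, norm_smul, norm_norm, hu, mul_one]
  have h := integral_sphere_exp_inner_mul_inner hV hu r α (β * ‖y‖)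
  simp_rw [hinner]
  have h1 : ∫ x in sphere (0 : V) r, ‖y‖ * ⟪u, x⟫ * Real.exp (α + β * (‖y‖ * ⟪u, x⟫))
      ∂(μHE[k] : Measure V) =
      ‖y‖ * ∫ x in sphere (0 : V) r, ⟪u, x⟫ * Real.exp (α + β * ‖y‖ * ⟪u, x⟫) ∂(μHE[k] : Measure V) := by
    rw [← integral_const_mul]
    refine integral_congr_ae (ae_of_all _ fun x ↦ ?_)
    ring_nf
  have h2 : ∫ x in sphere (0 : V) r, (r ^ 2 * ‖y‖ ^ 2 - (‖y‖ * ⟪u, x⟫) ^ 2) *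
      Real.exp (α + β * (‖y‖ * ⟪u, x⟫)) ∂(μHE[k] : Measure V) =
      ‖y‖ ^ 2 * ∫ x in sphere (0 : V) r, (r ^ 2 - ⟪u, x⟫ ^ 2) * Real.exp (α + β * ‖y‖ * ⟪u, x⟫)
        ∂(μHE[k] : Measure V) := by
    rw [← integral_const_mul]
    refine integral_congr_ae (ae_of_all _ fun x ↦ ?_)
    ring_nf
  rw [h1, h2, ← mul_assoc, mul_comm (k : ℝ) ‖y‖, mul_assoc, h]
  ring

end ExpInner

end Literature.MeasureTheory.Hausdorff

end
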